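import Literature.Probability.FitznerVanDerHofstad2017.MeanFieldD11AppD
import Literature.Probability.FitznerVanDerHofstad2017.MeanFieldD11Stage1TailsEvalRec
import HarnessLib

/-!
# Mean-field behaviour at `d = 11` on the kernel App.-D line, II: Assumption 4.3 RE-BASED on the typed Stage-1 recipe WITH
# TAILS (the record cell at the certified simple-random-walk tables) at BOTH points — the initial point through the auxiliary
# record `inputsI2` — and the kernel tie of the Stage-1 state to the certificate's `(Γ, c)` (W48.1)

ADDITIVE module (nothing of record is touched: `MeanFieldD11Cert` rev 6, `MeanFieldD11Inputs`, `MeanFieldD11Stage1EvalRec`,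
`MeanFieldD11Stage1TailsEvalRec`, `NobleInstantiate`, `NobleAssumptions` are imported unchanged; ONE `def` — the auxiliary input
record `D11.inputsI2`, item 4 — no `def … : Prop`, no named fact).

## What is proved

1. **Assumption 4.3 is monotone in its constants** (`NobleAssumption43At.of_dom`, generic `d`, `p`, split `S`): if the
   App.-D input record `i` DOMINATES `i'` in the information order `BetaMap.Inputs.Dom` (every upper-bound field of `i` is
   `≤` that of `i'`, the four lower-bound fields are `≥`, `mu ≤`) and `i'` is well formed (`BetaMap.Inputs.WF d i'`), then
   [NoBLE17] Assumption 4.3 for `(d, p, S)` with the constants `i` implies Assumption 4.3 with the constants `i'`.  Sixty-one of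
   the sixty-two displays (4.30)–(4.49) are monotone by transitivity of `≤`; the one that is not — (4.34)
   `(2d−1) μ̄_p/(1−μ_p) · β^abs_{Ξ^ι} < 1`, which gets HARDER as `β^abs_{Ξ^ι}` grows — is recovered at `i'` from the well-formedness
   field `tmp2_lt_one : 2d·mub/(1−mu)·β^abs_{Ξ^ι} < 1` OF THE TARGET record together with `μ̄_p = p ≤ i'.mub`, `μ_p ≤ i'.mu < 1`
   (`NobleAssumption43At.geom_lt_one_of_dom`).  This is the analytic counterpart of `BoundMapMonotone` (which transports the
   CERTIFICATE along `Dom`); here the ASSUMPTION is transported, in the opposite direction of use: whoever establishes (4.30)–(4.49)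
   with SHARPER constants has established them with the published ones.
2. **(S2a) at `d = 11`, improvement point, re-based on the typed Stage-1 recipe WITH TAILS.**  `MeanFieldD11Stage1TailsEvalRec`
   proves (kernel, `decide`) that the typed RECORD-CELL Stage-1 recipe INCLUDING the `N ≥ 4` tails of notebook cells 41–43 (through
   the closed-form tail majorant `Stage1Tails.Rec.inpMajQ` with the exact Neumann inverses `SQr`, `SbQr`), evaluated at the certified
   upper-endpoint SRW tables `CertD11.dataHi`, the parameters `CertD11.P = (11, 12, 28)` and the O12g state `CertD11Rec.stateRec`, is
   DOMINATED by the published numerals at the improvement point, all sixty fields: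
   `inpMajQrec_hi_dom_o : (inpMajQ dataHi P stateRec .o SQr SbQr).Dom D11.inputsO`.  With item 1 and the well-formedness of the
   numerals (`D11.inputsO_WF`, `MeanFieldD11AppD`):
   `nobleAssumption43At_inputsO_of_stage1Full : NobleAssumption43At 11 p S (inpMajQ dataHi P stateRec .o SQr SbQr) → NobleAssumption43At 11 p S inputsO`
   for EVERY `p` and EVERY split `S`, and the generic form `nobleAssumption43At_inputsO_of_dom` for ANY constants dominated by
   `inputsO`.  Consequently the `d = 11` sentence of `MeanFieldD11AppD` holds with its improvement-point hypothesis (S2a) stated at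
   the RECIPE'S OUTPUTS instead of at sixty decimal literals: `nobleImprovementInputsAt_d11_stage1`, `meanField_d11_stage1`,
   `percolationContinuity_d11_stage1`.  WHAT THIS BUYS: the remaining analytic statement at the improvement point, (S2a′)
   "Assumption 4.3 (4.30)–(4.49) holds for percolation on `ℤ^11` at every `p ∈ (p_I, p_c)` with `f(p) ≤ Γ`, with the constants
   COMPUTED BY THE TYPED STAGE-1 RECORD CELL WITH TAILS from the certified SRW tables at the state `(Γ₁, m, Γ₂, c)`", no longer
   mentions any outward-rounded decimal of the published table — it is [FvdH17] §§4–6 (the diagrammatic bounds behind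
   `Percolation.nb` cells 1–44) + the validity of the served SRW tables (GAPS G8 (δ1)–(δ4)); the sixty `≤`/`≥` comparisons with the
   published numerals are kernel (`MeanFieldD11Stage1TailsEvalRec`) and now CONSUMED.  AT THE INITIAL POINT `p_I` NO typed re-base
   is offered, for a kernel reason: there the typed record with tails is NOT dominated by `inputsI` — the field `xiIotaOdd` EXCEEDS
   the cited numeral `6.291245273866·10⁻⁴` by a relative amount in `(10⁻⁵, 1.5·10⁻⁵]` (`xiIotaOddRec_i_exceeds` / `_within`, programme
   DIVERGENCE D45: the cited numeral is the output of a run in a corrected class, the typed cells are the notebook AS CODED), while the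
   TAIL-FREE record IS dominated (`MeanFieldD11Stage1EvalRec.inpRrec_hi_dom_i`) but its constants omit the `N ≥ 4` tails that the
   derivation's bound contains, so a hypothesis at the tail-free constants would not be the derivation's output.  In `meanField_d11_stage1`
   the initial-point hypothesis therefore stays at the literal record `inputsI` exactly as in `MeanFieldD11AppD`; item 4 removes this
   last literal through an auxiliary record.
3. **W48.1 — the Stage-1 state IS the certificate's tuple** (kernel `norm_num`, namespace `Stage1Cells.CertD11Rec`):
   `stateRec_Gamma1 : stateRec.Γ₁ = D11.GammaC 0` (`1.0121756`), `stateRec_Gamma2 : stateRec.Γ₂ = D11.GammaC 1` (`1.1084502`),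
   `stateRec_m_eq : stateRec.m = D11.GammaC 0 / ((2·11 − 1) · D11.cMuC)` (`m = Γ₁/((2d−1)c_μ) = 10121756/210608601`),
   `stateRec_c : stateRec.c j = D11.cWeightsC (σ j)` with `σ = (5, 0, 1, 2, 3, 4)` — the Stage-1 state lists the weight of the triple
   `(1,6,{0})` FIRST and then `(0,0,𝒳), (1,0,𝒳), (1,1,𝒳), (1,2,𝒳), (1,3,𝒳)` (header of `MeanFieldD11Stage1EvalRec`), whereas the
   certificate's `cWeightsC` follows `nobleTriple` (`GaussianDominationRouteNoble`), which lists `(1,6,{0})` LAST; equivalently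
   `stateRec.c (finRotate 6 k) = cWeightsC k` (`stateRec_c_finRotate`).  So the `Γ_j` of the bootstrap hypothesis `f_j(p) ≤ Γ_j` in
   `NobleImprovementInputsAt 11 cMuC cWeightsC GammaC …` and the `(Γ₁, Γ₂, c)` fed to the Stage-1 recipe are the SAME numbers, by the
   kernel and not by inspection.

4. **(S2a) at the INITIAL point re-based too — the auxiliary record `inputsI2`** (namespace `D11`, §4 below).  `inputsI2 :=
   { inputsI with xiIotaOdd := 6.291245273866·10⁻⁴ · (1 + 3/200000) }` replaces the ONE offending field by the kernel-certified upper
   bound of the typed value (`xiIotaOddRec_i_within`); then (a) the typed record with tails at point `i` is dominated by `inputsI2`, all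
   sixty fields (`inpMajQrec_hi_dom_i2`, assembled from `inpRrec_hi_dom_i`, `tailsRec_hi_i`, `xiIotaOddRec_i_within`); (b) `inputsI2` is
   well formed and satisfies (N1′)/(N2)/(N3) (the replaced field enters none of them); (c) the `F`-side hypothesis at the PUBLISHED
   `β(inputsI)` implies the one at `β(inputsI2)` (`fSide_inputsI2_of_inputsI`: `α_F^low` does not read the field, `β_Δ(inputsI) ≤ β_Δ(inputsI2)`
   by `norm_num` through the typed (D.32), `1 − D̂ ≥ 0`), so the oracle lane's target is unchanged; (d) the input-level certificate
   `P(γ, Γ)` holds at `(β(inputsI2), β(inputsO))` (`nobleCertificate_d11_inputsI2`: the three initial-stage inequalities re-evaluated by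
   `norm_num`, initial-stage margins `≈ 1.6·10⁻³ / 4.5·10⁻²` against a `β`-shift `< 10⁻⁷`; the six others are the record's).  HEADLINE
   `meanField_d11_typedStage1` / `percolationContinuity_d11_typedStage1`: BOTH Assumption-4.3 hypotheses are stated at the typed recipe's
   outputs `inpMajQ dataHi P stateRec .i/.o SQr SbQr`; NO published Stage-1 decimal remains in an (S2a) hypothesis.  `inputsI2` is NOT a
   certificate of record and NOT a published numeral — an auxiliary kernel object, every use of which is kernel-proved; the certificate
   of record (`MeanFieldD11Cert` rev 6 / `MeanFieldD11Inputs` rev 6) is untouched and remains the one cited.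

## Scope of the re-based hypothesis (S2a′) — read before citing it

(S2a′) is stated at the typed record cell AS TYPED: `Stage1CellsRec` / `Stage1TailsRec` = the weighted-bubble cell of record over
`Stage1Cells` / `Stage1Tails`, which transcribe `Percolation.nb` cells 1–44 AS CODED (in particular the closed / open repulsive-polygon
cells 11/12 with the coded multiplicities), the tails through their closed-form majorant.  The multiplicity revision recorded in
HOME/DIVERGENCE.md D57 (node N72(b): typed twins of the four polygon cells with the derivation-line counts, plus the order lemmas
`cell ≤ cell^{D57}`) is NOT part of these modules; nothing here asserts that the coded cells bound the lattice quantities they name.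
When such twins land, the SAME transport applies one step up (`NobleAssumption43At.of_dom` along the order lemma, then along their
own domination by the numerals), and the generic forms `nobleAssumption43At_inputsO_of_dom` / `_inputsI_of_dom` below serve ANY
constants dominated by the published numerals — the typed record cell with tails at the certified upper-endpoint tables, point `o`,
is one instance (`inpMajQrec_hi_dom_o`); the tail-free record at both points is another (`inpRrec_hi_dom_o/_i`, stated below as
`…_of_stage1Rec` and labelled TAIL-FREE: a `Dom`-transport instance, not the derivation's output).

## Hypothesis inventory of `meanField_d11_stage1` / `meanField_d11_typedStage1` (every binder displayed; none cited, none minted)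

* (S2a′) `NobleAssumption43At 11 p (percolationNobleSplit 11 p _ _) (inpMajQ dataHi P stateRec .o SQr SbQr)` on the window under
  `f ≤ Γ` — [NoBLE17] Assumption 4.3 with the recipe's constants, tails included ([FvdH17] §§4–6, App. D Step 1 for `μ`, `μ̄`;
  programme route GAPS G8: recipe validity (δ1)–(δ4) + table validity); (S2a at `p_I`) `NobleAssumption43At 11 p_I (…) inputsI` at
  the literal record (unchanged from `MeanFieldD11AppD`, for the kernel reason given in item 2) — resp., in `meanField_d11_typedStage1`,
  (S2a′ at `p_I`) `NobleAssumption43At 11 p_I (…) (inpMajQ dataHi P stateRec .i SQr SbQr)` at the typed recipe's outputs (item 4);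
* (S2b) `NobleWeightedDiagramBoundAt 11 p bo` / `… p_I bi` — [FvdH17] Prop. 2.2 (unchanged);
* (F) the `F`-side dispersive bound (D.3)+(D.32) at `nobleBetaOfInputs 11 inputsO` / `inputsI` (unchanged; oracle lane, App. D Steps 3–5).
Kernel-discharged (by import and here): everything listed in `MeanFieldD11AppD`, the sixty numeral comparisons at each point (with tails),
the certificate at `(β(inputsI2), β(inputsO))`, and the `F`-side transfer `β(inputsI) ↦ β(inputsI2)`.

`d = 11` only.  No statement about any other dimension is made or implied.  Axioms: `propext`, `Classical.choice`, `Quot.sound`.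
WORDING (REFEREE W49.1, applies to this module's sentences and supersedes the phrase in `MeanFieldD11AppD`'s docstrings): "[FvdH17]
Thm 1.1 / Cor. 1.3 (d = 11)" is cited for the STATEMENT; what is certified here is the re-evaluation of the bootstrap inequalities
with certified arithmetic (Cert rev 6) — the analytic hypotheses are typed binders, see the inventory above, not re-proved.

[cite: FitznerVanDerHofstad2016NoBLE, Assumption 4.3 (4.30)–(4.49) pp. 1086–1088; App. D Step 1 p. 1110; Prop. 4.5 p. 1088]
[cite: FitznerVanDerHofstad2017, Thm 1.1 / Cor. 1.3 (d = 11); §2.5 (Γ, c_μ, c); §§4–6; notebook Percolation.nb cells 1–44 (41–43: tails)]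
-/

noncomputable section

namespace Literature.Probability.FitznerVanDerHofstad2017

open _root_.MeasureTheory _root_.Filter _root_.Topology Literature.Probability.LatticeModels
open Literature.Barriers.CriticalPhenomena Literature.Probability.Percolation
open scoped BigOperators

variable {d : ℕ}

/-! ## 1. Assumption 4.3 is monotone in its constants along `Inputs.Dom` -/

/-- `Σ_x f(x) ≤ β` and `β ≤ β'` give `Σ_x f(x) ≤ β'`. [folklore] -/
theorem SumLE.mono_right {f : Site d → ℝ} {β β' : ℝ} (h : SumLE f β) (hβ : β ≤ β') : SumLE f β' :=
  ⟨h.1, h.2.trans hβ⟩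

/-- `Σ_N Σ_x f^{(N)}(x) ≤ β` and `β ≤ β'` give `Σ_N Σ_x f^{(N)}(x) ≤ β'`. [folklore] -/
theorem NSumLE.mono_right {f : ℕ → Site d → ℝ} {β β' : ℝ} (h : NSumLE f β) (hβ : β ≤ β') : NSumLE f β' :=
  ⟨h.1, h.2.1, h.2.2.trans hβ⟩

/-- **(4.34) along `Dom` into the well-formed region.**  If `i.Dom i'`, `i'` is well formed at `d`, and Assumption 4.3 holds
with `i` (so `μ̄_p = p ≤ i.mub ≤ i'.mub` and `μ_p ≤ i.mu ≤ i'.mu < 1`), then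
`(2d−1)·p/(1−μ_p)·i'.β^abs_{Ξ^ι} ≤ 2d·i'.mub/(1−i'.mu)·i'.β^abs_{Ξ^ι} < 1` by `tmp2_lt_one` of `i'`.
[cite: FitznerVanDerHofstad2016NoBLE, Assumption 4.3 (4.34) p. 1086; App. D (D.13)] -/
theorem NobleAssumption43At.geom_lt_one_of_dom {p : unitInterval} {S : NobleSplit d p} {i i' : BetaMap.Inputs}
    (hD : i.Dom i') (hW : BetaMap.Inputs.WF (d : ℝ) i') (h : NobleAssumption43At d p S i) :
    (2 * d - 1) * (p : ℝ) / (1 - nobleMu d p) * i'.xiIotaAbs < 1 := by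
  have hp0 : 0 ≤ (p : ℝ) := p.2.1
  have hpb : (p : ℝ) ≤ i'.mub := h.mub_le.trans hD.mub
  have hmu : nobleMu d p ≤ i'.mu := h.mu_le.trans hD.mu
  have hmu1 : i'.mu < 1 := hW.mu_lt_one
  have hξ : 0 ≤ i'.xiIotaAbs := hW.xiIotaAbs
  have hd0 : (0 : ℝ) ≤ d := Nat.cast_nonneg d
  have hnum : (2 * (d : ℝ) - 1) * (p : ℝ) ≤ 2 * (d : ℝ) * i'.mub := by nlinarith
  have hnum0 : 0 ≤ 2 * (d : ℝ) * i'.mub := by nlinarith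
  have hden0 : 0 < 1 - i'.mu := by linarith
  have hden : 1 - i'.mu ≤ 1 - nobleMu d p := by linarith
  have key : (2 * (d : ℝ) - 1) * (p : ℝ) / (1 - nobleMu d p) ≤ 2 * (d : ℝ) * i'.mub / (1 - i'.mu) :=
    (div_le_div_of_nonneg_right hnum (hden0.le.trans hden)).trans (div_le_div_of_nonneg_left hnum0 hden0 hden)
  calc (2 * (d : ℝ) - 1) * (p : ℝ) / (1 - nobleMu d p) * i'.xiIotaAbs
      ≤ 2 * (d : ℝ) * i'.mub / (1 - i'.mu) * i'.xiIotaAbs := mul_le_mul_of_nonneg_right key hξ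
    _ < 1 := hW.tmp2_lt_one

/-- **[NoBLE17] Assumption 4.3 is monotone in its constants along the information order, into the well-formed region.**
If `i.Dom i'` (every bound in `i` is at least as sharp as the corresponding bound in `i'`), `i'` is well formed at `d`, and
(4.30)–(4.49) hold for `(d, p, S)` with the constants `i`, then they hold with the constants `i'`.  Sixty-one displays by
transitivity; (4.34) by `geom_lt_one_of_dom`.  No hypothesis on `p` or `S`.
[cite: FitznerVanDerHofstad2016NoBLE, Assumption 4.3 (4.30)–(4.49) pp. 1086–1088; App. D Step 1 p. 1110] -/
theorem NobleAssumption43At.of_dom {p : unitInterval} {S : NobleSplit d p} {i i' : BetaMap.Inputs}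
    (hD : i.Dom i') (hW : BetaMap.Inputs.WF (d : ℝ) i') (h : NobleAssumption43At d p S i) :
    NobleAssumption43At d p S i' where
  tauHat_nonneg := h.tauHat_nonneg
  mubOverMu := h.mubOverMu.trans (mul_le_mul_of_nonneg_right hD.mubOverMu (nobleMu_nonneg d p))
  muMin := hD.muMin.trans h.muMin
  mu_le := h.mu_le.trans hD.mu
  mub_le := h.mub_le.trans hD.mub
  xiAbs := h.xiAbs.mono_right hD.xiAbs
  xiOdd := h.xiOdd.mono_right hD.xiOdd
  xiEven := h.xiEven.mono_right hD.xiEven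
  xiEvenTail := h.xiEvenTail.mono_right hD.xiEvenTail
  xiOddTail := h.xiOddTail.mono_right hD.xiOddTail
  xiDeltaAbs := h.xiDeltaAbs.mono_right hD.xiDeltaAbs
  xiOddDelta := h.xiOddDelta.mono_right hD.xiOddDelta
  xiEvenDelta := h.xiEvenDelta.mono_right hD.xiEvenDelta
  xiOddTailDelta := h.xiOddTailDelta.mono_right hD.xiOddTailDelta
  xiEvenTailDelta := h.xiEvenTailDelta.mono_right hD.xiEvenTailDelta
  xiIotaAbs := fun ι => (h.xiIotaAbs ι).mono_right hD.xiIotaAbs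
  xiIotaOdd := fun ι => (h.xiIotaOdd ι).mono_right hD.xiIotaOdd
  xiIotaEven := fun ι => (h.xiIotaEven ι).mono_right hD.xiIotaEven
  xiIotaEvenTail := fun ι => (h.xiIotaEvenTail ι).mono_right hD.xiIotaEvenTail
  xiIotaDeltaZero := fun ι => (h.xiIotaDeltaZero ι).mono_right hD.xiIotaDeltaZero
  xiIotaOddDeltaZero := fun ι => (h.xiIotaOddDeltaZero ι).mono_right hD.xiIotaOddDeltaZero
  xiIotaEvenDeltaZero := fun ι => (h.xiIotaEvenDeltaZero ι).mono_right hD.xiIotaEvenDeltaZero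
  xiIotaEvenTailDeltaZero := fun ι => (h.xiIotaEvenTailDeltaZero ι).mono_right hD.xiIotaEvenTailDeltaZero
  xiIotaDeltaEi := fun ι => (h.xiIotaDeltaEi ι).mono_right hD.xiIotaDeltaEi
  xiIotaOddDeltaEi := fun ι => (h.xiIotaOddDeltaEi ι).mono_right hD.xiIotaOddDeltaEi
  xiIotaEvenDeltaEi := fun ι => (h.xiIotaEvenDeltaEi ι).mono_right hD.xiIotaEvenDeltaEi
  xiIotaEvenTailDeltaEi := fun ι => (h.xiIotaEvenTailDeltaEi ι).mono_right hD.xiIotaEvenTailDeltaEi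
  geom_lt_one := NobleAssumption43At.geom_lt_one_of_dom hD hW h
  psiZeroLower := fun ι => ⟨(h.psiZeroLower ι).1, hD.psiZeroLower.trans (h.psiZeroLower ι).2⟩
  piOneLower := fun ι => ⟨(h.piOneLower ι).1, hD.piOneLower.trans (h.piOneLower ι).2⟩
  xiAlphaAtZero_lower := (neg_le_neg hD.xiAlphaOneMinusZeroAtZero).trans h.xiAlphaAtZero_lower
  xiAlphaAtZero_upper := h.xiAlphaAtZero_upper.trans hD.xiAlphaZeroMinusOneAtZero
  xiAlphaAtEi_lower := fun ι => (neg_le_neg hD.xiAlphaOneMinusZeroAtEi).trans (h.xiAlphaAtEi_lower ι)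
  xiAlphaAtEi_upper := fun ι => (h.xiAlphaAtEi_upper ι).trans hD.xiAlphaZeroMinusOneAtEi
  xiIotaAlphaIAtEi := fun ι => (h.xiIotaAlphaIAtEi ι).trans hD.xiIotaAlphaIAtEi
  xiIotaAlphaISumAroundEi := fun ι => (h.xiIotaAlphaISumAroundEi ι).trans hD.xiIotaAlphaISumAroundEi
  xiIotaAlphaIIAtZero := fun ι => (h.xiIotaAlphaIIAtZero ι).trans hD.xiIotaAlphaIIAtZero
  xiIotaAlphaIISumAroundZero := fun ι => (h.xiIotaAlphaIISumAroundZero ι).trans hD.xiIotaAlphaIISumAroundZero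
  psiAlphaIAroundEi_lower := fun ι => (neg_le_neg hD.psiAlphaIOneMinusZeroAroundEi).trans (h.psiAlphaIAroundEi_lower ι)
  psiAlphaIAroundEi_upper := fun ι => (h.psiAlphaIAroundEi_upper ι).trans hD.psiAlphaIZeroMinusOneAroundEi
  psiAlphaIIAroundZero_lower := fun ι => (neg_le_neg hD.psiAlphaIIOneMinusZeroAroundZero).trans (h.psiAlphaIIAroundZero_lower ι)
  psiAlphaIIAroundZero_upper := fun ι => (h.psiAlphaIIAroundZero_upper ι).trans hD.psiAlphaIIZeroMinusOneAroundZero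
  piAlpha_lower := fun ι => hD.piAlphaLower.trans (h.piAlpha_lower ι)
  piAlpha_upper := fun ι => (h.piAlpha_upper ι).trans hD.piAlpha
  xiR0 := h.xiR0.mono_right hD.xiR0
  xiR1 := h.xiR1.mono_right hD.xiR1
  xiR0Delta := h.xiR0Delta.mono_right hD.xiR0Delta
  xiR1Delta := h.xiR1Delta.mono_right hD.xiR1Delta
  psiRI0 := fun ι => (h.psiRI0 ι).mono_right hD.psiRI0
  psiRI1 := fun ι => (h.psiRI1 ι).mono_right hD.psiRI1
  psiRI0Delta := fun ι => (h.psiRI0Delta ι).mono_right hD.psiRI0Delta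
  psiRI1Delta := fun ι => (h.psiRI1Delta ι).mono_right hD.psiRI1Delta
  psiRII0 := fun ι => (h.psiRII0 ι).mono_right hD.psiRII0
  psiRII1 := fun ι => (h.psiRII1 ι).mono_right hD.psiRII1
  psiRII0Delta := fun ι => (h.psiRII0Delta ι).mono_right hD.psiRII0Delta
  psiRII1Delta := fun ι => (h.psiRII1Delta ι).mono_right hD.psiRII1Delta
  xiIotaRI0 := fun ι => (h.xiIotaRI0 ι).mono_right hD.xiIotaRI0
  xiIotaRI0DeltaEi := fun ι => (h.xiIotaRI0DeltaEi ι).mono_right hD.xiIotaRI0DeltaEi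
  xiIotaRII0 := fun ι => (h.xiIotaRII0 ι).mono_right hD.xiIotaRII0
  xiIotaRII0DeltaZero := fun ι => (h.xiIotaRII0DeltaZero ι).mono_right hD.xiIotaRII0DeltaZero
  piR0 := fun κ => ⟨(h.piR0 κ).1, (h.piR0 κ).2.trans hD.piR0⟩
  piR0DeltaEiEk := ⟨h.piR0DeltaEiEk.1, h.piR0DeltaEiEk.2.trans hD.piR0DeltaEiEk⟩

/-! ## 3. W48.1 — the Stage-1 state is the certificate's `(Γ₁, Γ₂, c_μ, c)` -/

namespace Stage1Cells.CertD11Rec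

/-- `Γ₁` of the Stage-1 state is the certificate's `Γ₁ = GammaC 0 = 1.0121756`. [folklore] -/
theorem stateRec_Gamma1 : ((stateRec.Gamma1 : ℚ) : ℝ) = D11.GammaC 0 := by
  norm_num [stateRec, D11.GammaC]

/-- `Γ₂` of the Stage-1 state is the certificate's `Γ₂ = GammaC 1 = 1.1084502`. [folklore] -/
theorem stateRec_Gamma2 : ((stateRec.Gamma2 : ℚ) : ℝ) = D11.GammaC 1 := by
  norm_num [stateRec, D11.GammaC]

/-- `m` of the Stage-1 state is `Γ₁/((2d−1)c_μ)` with the certificate's `Γ₁ = GammaC 0`, `c_μ = cMuC`, `d = 11`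
(App. D Step 1: the bound used for `μ_p` under `f₁(p) ≤ Γ₁`). [cite: FitznerVanDerHofstad2016NoBLE, App. D Step 1 p. 1110] -/
theorem stateRec_m_eq : ((stateRec.m : ℚ) : ℝ) = D11.GammaC 0 / ((2 * 11 - 1) * D11.cMuC) := by
  norm_num [stateRec, D11.GammaC, D11.cMuC]

/-- `c`-weight dictionary, entry by entry: state slot `0` = `(1,6,{0})` = `nobleTriple` slot `5`. [cite: FitznerVanDerHofstad2017, (2.23) and §2.5] -/
theorem stateRec_c0 : ((stateRec.c 0 : ℚ) : ℝ) = D11.cWeightsC 5 := by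
  simp only [stateRec, D11.cWeightsC, Matrix.cons_val]; norm_num

/-- state slot `1` = `(0,0,𝒳)` = `nobleTriple` slot `0`. [cite: FitznerVanDerHofstad2017, (2.23) and §2.5] -/
theorem stateRec_c1 : ((stateRec.c 1 : ℚ) : ℝ) = D11.cWeightsC 0 := by
  simp only [stateRec, D11.cWeightsC, Matrix.cons_val]; norm_num

/-- state slot `2` = `(1,0,𝒳)` = `nobleTriple` slot `1`. [cite: FitznerVanDerHofstad2017, (2.23) and §2.5] -/
theorem stateRec_c2 : ((stateRec.c 2 : ℚ) : ℝ) = D11.cWeightsC 1 := by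
  simp only [stateRec, D11.cWeightsC, Matrix.cons_val]; norm_num

/-- state slot `3` = `(1,1,𝒳)` = `nobleTriple` slot `2`. [cite: FitznerVanDerHofstad2017, (2.23) and §2.5] -/
theorem stateRec_c3 : ((stateRec.c 3 : ℚ) : ℝ) = D11.cWeightsC 2 := by
  simp only [stateRec, D11.cWeightsC, Matrix.cons_val]; norm_num

/-- state slot `4` = `(1,2,𝒳)` = `nobleTriple` slot `3`. [cite: FitznerVanDerHofstad2017, (2.23) and §2.5] -/
theorem stateRec_c4 : ((stateRec.c 4 : ℚ) : ℝ) = D11.cWeightsC 3 := by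
  simp only [stateRec, D11.cWeightsC, Matrix.cons_val]; norm_num

/-- state slot `5` = `(1,3,𝒳)` = `nobleTriple` slot `4`. [cite: FitznerVanDerHofstad2017, (2.23) and §2.5] -/
theorem stateRec_c5 : ((stateRec.c 5 : ℚ) : ℝ) = D11.cWeightsC 4 := by
  simp only [stateRec, D11.cWeightsC, Matrix.cons_val]; norm_num

/-- The `f₃`-weights of the Stage-1 state are the certificate's `cWeightsC`, up to the index dictionary `σ = (5,0,1,2,3,4)`:
the state lists `(1,6,{0})` first, `nobleTriple` lists it last. [cite: FitznerVanDerHofstad2017, (2.23) and §2.5] -/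
theorem stateRec_c (j : Fin 6) : ((stateRec.c j : ℚ) : ℝ) = D11.cWeightsC ((![5, 0, 1, 2, 3, 4] : Fin 6 → Fin 6) j) := by
  fin_cases j
  exacts [stateRec_c0, stateRec_c1, stateRec_c2, stateRec_c3, stateRec_c4, stateRec_c5]

/-- The same dictionary as a rotation: `stateRec.c (finRotate 6 k) = cWeightsC k` (`finRotate 6 k = k + 1 (mod 6)`).
[cite: FitznerVanDerHofstad2017, (2.23) and §2.5] -/
theorem stateRec_c_finRotate (k : Fin 6) : ((stateRec.c (finRotate 6 k) : ℚ) : ℝ) = D11.cWeightsC k := by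
  fin_cases k
  exacts [stateRec_c1, stateRec_c2, stateRec_c3, stateRec_c4, stateRec_c5, stateRec_c0]

end Stage1Cells.CertD11Rec

/-! ## 2. (S2a) at `d = 11`, improvement point, re-based on the typed Stage-1 record-cell recipe WITH TAILS at the certified tables -/

namespace D11

open NoGoFrame Stage1Cells Stage1Cells.CertD11Rec
open Stage1Cells.CertD11 (P dataHi)
open Stage1Tails.Rec (inpMajQ)

/-- **(S2a) transport to the published numerals, improvement point, ANY dominated constants.**  Assumption 4.3 at
`(11, p, S)` with constants `i` that DOMINATE the published record `inputsO` (`i.Dom inputsO`) implies Assumption 4.3 with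
`inputsO` (kernel: `inputsO_WF`, `NobleAssumption43At.of_dom`).  This is the form every sharper Stage-1 evaluation plugs into.
[cite: FitznerVanDerHofstad2016NoBLE, Assumption 4.3 pp. 1086–1088] -/
theorem nobleAssumption43At_inputsO_of_dom {p : unitInterval} {S : NobleSplit 11 p} {i : BetaMap.Inputs}
    (hi : i.Dom inputsO) (h : NobleAssumption43At 11 p S i) : NobleAssumption43At 11 p S inputsO :=
  h.of_dom hi inputsO_WF.1

/-- **(S2a) transport to the published numerals, initial point, ANY dominated constants** (`i.Dom inputsI`).
[cite: FitznerVanDerHofstad2016NoBLE, Assumption 4.3 pp. 1086–1088 (z = z_I)] -/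
theorem nobleAssumption43At_inputsI_of_dom {p : unitInterval} {S : NobleSplit 11 p} {i : BetaMap.Inputs}
    (hi : i.Dom inputsI) (h : NobleAssumption43At 11 p S i) : NobleAssumption43At 11 p S inputsI :=
  h.of_dom hi inputsI_WF.1

/-- **(S2a) transport, improvement point, the typed record WITH TAILS.**  Assumption 4.3 at `(11, p, S)` with the constants
COMPUTED by the typed Stage-1 record cell INCLUDING the `N ≥ 4` tails (closed-form majorant `inpMajQ`, exact Neumann inverses
`SQr`, `SbQr`) from the certified upper-endpoint SRW tables at the O12g state implies Assumption 4.3 with the published numerals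
`inputsO` (kernel: `inpMajQrec_hi_dom_o`, `inputsO_WF`, `NobleAssumption43At.of_dom`).
[cite: FitznerVanDerHofstad2016NoBLE, Assumption 4.3 pp. 1086–1088] [cite: FitznerVanDerHofstad2017, §§4–6; notebook Percolation.nb cells 41–44] -/
theorem nobleAssumption43At_inputsO_of_stage1Full {p : unitInterval} {S : NobleSplit 11 p}
    (h : NobleAssumption43At 11 p S (inpMajQ dataHi P stateRec .o SQr SbQr)) : NobleAssumption43At 11 p S inputsO :=
  nobleAssumption43At_inputsO_of_dom inpMajQrec_hi_dom_o h

/-- (TAIL-FREE variant `T″₀`, a `Dom`-transport instance and NOT the derivation's output — see the module header, Scope.)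
Assumption 4.3 with the constants of the tail-free typed record cell at the certified tables, point `o`, implies Assumption 4.3
with `inputsO` (kernel: `MeanFieldD11Stage1EvalRec.inpRrec_hi_dom_o`). [cite: FitznerVanDerHofstad2016NoBLE, Assumption 4.3 pp. 1086–1088] -/
theorem nobleAssumption43At_inputsO_of_stage1Rec {p : unitInterval} {S : NobleSplit 11 p}
    (h : NobleAssumption43At 11 p S (dataHi.inpRrec P stateRec .o)) : NobleAssumption43At 11 p S inputsO :=
  nobleAssumption43At_inputsO_of_dom inpRrec_hi_dom_o h

/-- (TAIL-FREE variant `T″₀`, point `i`; a `Dom`-transport instance, NOT the derivation's output — see the module header, item 2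
and Scope; kernel: `MeanFieldD11Stage1EvalRec.inpRrec_hi_dom_i`.) [cite: FitznerVanDerHofstad2016NoBLE, Assumption 4.3 pp. 1086–1088 (z = z_I)] -/
theorem nobleAssumption43At_inputsI_of_stage1Rec {p : unitInterval} {S : NobleSplit 11 p}
    (h : NobleAssumption43At 11 p S (dataHi.inpRrec P stateRec .i)) : NobleAssumption43At 11 p S inputsI :=
  nobleAssumption43At_inputsI_of_dom inpRrec_hi_dom_i h

/-- **The improvement-step oracle binder at `d = 11`, (S2a) at the recipe's outputs (with tails).**
[cite: FitznerVanDerHofstad2016NoBLE, Prop. 4.5 (p. 1088); Assumption 4.3] [cite: FitznerVanDerHofstad2017, Prop. 2.2 (EJP p. 11); §§4–6] -/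
theorem nobleImprovementInputsAt_d11_stage1
    (h : ∀ (p : unitInterval) (hp : p ∈ Set.Ioo (nbwThresholdI 11) (criticalProbI 11)),
      (∀ j, Literature.Barriers.CriticalPhenomena.nobleF 11 cMuC cWeightsC j p ≤ GammaC j) →
        NobleAssumption43At 11 p (percolationNobleSplit 11 p two_le_eleven hp.2) (inpMajQ dataHi P stateRec .o SQr SbQr) ∧
        (∀ k ∈ cube 11,
          ((BetaMap.nobleBetaOfInputs ((11 : ℕ) : ℝ) inputsO).αFlow -
              (BetaMap.nobleBetaOfInputs ((11 : ℕ) : ℝ) inputsO).βΔ) * (1 - Dhat 11 k) ≤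
            cosFT (nobleF 11 p) 0 - cosFT (nobleF 11 p) k) ∧
        NobleWeightedDiagramBoundAt 11 p bo) :
    NobleImprovementInputsAt 11 cMuC cWeightsC GammaC (BetaMap.nobleBetaOfInputs 11 inputsO) bo :=
  nobleImprovementInputsAt_d11_appD fun p hp hΓ =>
    let ⟨h43, hF, hW⟩ := h p hp hΓ
    ⟨nobleAssumption43At_inputsO_of_stage1Full h43, hF, hW⟩

/-- **Mean-field behaviour at `d = 11` on the kernel App.-D line, (S2a) at the improvement point stated at the typed Stage-1
recipe's outputs (with tails).**  REMAINING HYPOTHESES (displayed, not citable as typed): (S2a at `p_I`) Assumption 4.3 for the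
percolation split at `p_I` with the published constants `inputsI`; (S2a′) Assumption 4.3 on `(p_I, p_c)` under `f ≤ Γ` with the
constants computed by the typed record-cell Stage-1 recipe with tails from the certified SRW tables at the state `(Γ₁, m, Γ₂, c)`;
(S2b) [FvdH17] Prop. 2.2's weighted-diagram bounds `bi`, `bo`; (F) App. D (D.3)+(D.32) at the published `β`-inputs.  Conclusion:
triangle condition, `θ(p_c) = 0`, and `β = 1` in the bounded-ratio form on `ℤ^11`.
[cite: FitznerVanDerHofstad2017, Thm 1.1 / Cor. 1.3 (d = 11: the bootstrap inequalities re-evaluated with certified arithmetic, Cert rev 6; analytic hypotheses typed, see header)]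
[cite: FitznerVanDerHofstad2016NoBLE, Thm 2.10, Prop. 2.11, Prop. 4.5, App. D] -/
theorem meanField_d11_stage1
    (hI43 : NobleAssumption43At 11 (nbwThresholdI 11)
      (percolationNobleSplit 11 (nbwThresholdI 11) two_le_eleven (nbwThresholdI_lt_criticalProbI two_le_eleven)) inputsI)
    (hIF : ∀ k ∈ cube 11,
      ((BetaMap.nobleBetaOfInputs ((11 : ℕ) : ℝ) inputsI).αFlow - (BetaMap.nobleBetaOfInputs ((11 : ℕ) : ℝ) inputsI).βΔ) *
        (1 - Dhat 11 k) ≤ cosFT (nobleF 11 (nbwThresholdI 11)) 0 - cosFT (nobleF 11 (nbwThresholdI 11)) k)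
    (hIW : NobleWeightedDiagramBoundAt 11 (nbwThresholdI 11) bi)
    (hS : ∀ (p : unitInterval) (hp : p ∈ Set.Ioo (nbwThresholdI 11) (criticalProbI 11)),
      (∀ j, Literature.Barriers.CriticalPhenomena.nobleF 11 cMuC cWeightsC j p ≤ GammaC j) →
        NobleAssumption43At 11 p (percolationNobleSplit 11 p two_le_eleven hp.2) (inpMajQ dataHi P stateRec .o SQr SbQr) ∧
        (∀ k ∈ cube 11,
          ((BetaMap.nobleBetaOfInputs ((11 : ℕ) : ℝ) inputsO).αFlow -
              (BetaMap.nobleBetaOfInputs ((11 : ℕ) : ℝ) inputsO).βΔ) * (1 - Dhat 11 k) ≤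
            cosFT (nobleF 11 p) 0 - cosFT (nobleF 11 p) k) ∧
        NobleWeightedDiagramBoundAt 11 p bo) :
    TriangleCondition 11 ∧ PercolationContinuity 11 ∧ BetaEqOneBoundedRatio 11 :=
  meanField_d11_inputs (nobleInitialInputsAt_d11_appD hI43 hIF hIW) (nobleImprovementInputsAt_d11_stage1 hS)

/-- `θ(p_c) = 0` on `ℤ^11` on the kernel App.-D line, (S2a) at the improvement point stated at the typed Stage-1 recipe's outputs
with tails (hypotheses as in `meanField_d11_stage1`). [cite: FitznerVanDerHofstad2017, Cor. 1.3 (d = 11)] -/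
theorem percolationContinuity_d11_stage1
    (hI43 : NobleAssumption43At 11 (nbwThresholdI 11)
      (percolationNobleSplit 11 (nbwThresholdI 11) two_le_eleven (nbwThresholdI_lt_criticalProbI two_le_eleven)) inputsI)
    (hIF : ∀ k ∈ cube 11,
      ((BetaMap.nobleBetaOfInputs ((11 : ℕ) : ℝ) inputsI).αFlow - (BetaMap.nobleBetaOfInputs ((11 : ℕ) : ℝ) inputsI).βΔ) *
        (1 - Dhat 11 k) ≤ cosFT (nobleF 11 (nbwThresholdI 11)) 0 - cosFT (nobleF 11 (nbwThresholdI 11)) k)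
    (hIW : NobleWeightedDiagramBoundAt 11 (nbwThresholdI 11) bi)
    (hS : ∀ (p : unitInterval) (hp : p ∈ Set.Ioo (nbwThresholdI 11) (criticalProbI 11)),
      (∀ j, Literature.Barriers.CriticalPhenomena.nobleF 11 cMuC cWeightsC j p ≤ GammaC j) →
        NobleAssumption43At 11 p (percolationNobleSplit 11 p two_le_eleven hp.2) (inpMajQ dataHi P stateRec .o SQr SbQr) ∧
        (∀ k ∈ cube 11,
          ((BetaMap.nobleBetaOfInputs ((11 : ℕ) : ℝ) inputsO).αFlow -
              (BetaMap.nobleBetaOfInputs ((11 : ℕ) : ℝ) inputsO).βΔ) * (1 - Dhat 11 k) ≤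
            cosFT (nobleF 11 p) 0 - cosFT (nobleF 11 p) k) ∧
        NobleWeightedDiagramBoundAt 11 p bo) :
    PercolationContinuity 11 :=
  (meanField_d11_stage1 hI43 hIF hIW hS).2.1

end D11

/-! ## 4. (S2a) at the INITIAL point re-based on the typed Stage-1 recipe WITH TAILS, through the auxiliary record `inputsI2` -/

namespace D11

open NoGoFrame Stage1Cells Stage1Cells.CertD11Rec
open Stage1Cells.CertD11 (P dataHi cast_le_of le_cast_of castAdd1_le_of castAdd2_le_of)
open Stage1Tails.Rec (inpMajQ tailValQ)

/-- **The auxiliary initial-point input record `inputsI2`** := the published record `inputsI` with ONE field replaced: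
`xiIotaOdd := 6.291245273866·10⁻⁴ · (1 + 3/200000)` — the published numeral times the kernel slack factor of
`MeanFieldD11Stage1TailsEvalRec.xiIotaOddRec_i_within`, i.e. a kernel-certified UPPER bound of the typed Stage-1 record cell WITH
TAILS at the certified tables, point `i` (the typed value EXCEEDS the published numeral itself: `xiIotaOddRec_i_exceeds`,
programme DIVERGENCE D45).  NOT a certificate of record and NOT a published numeral: an auxiliary kernel object whose only
purpose is to let the initial-point hypothesis (S2a) be stated at the typed recipe's outputs (`meanField_d11_typedStage1`).
Every use below is kernel-proved (domination by `decide`, the certificate by `norm_num`).  `inputsI.Dom inputsI2` (it is WEAKER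
than the published record). [cite: FitznerVanDerHofstad2017, §4 and Figure 3 (d = 11 inputs); notebook Percolation.nb cells 41–44] -/
def inputsI2 : BetaMap.Inputs := { inputsI with xiIotaOdd := 0.0006291245273866 * (1 + 3 / 200000) }

/-- the replaced field, as a numeral identity. [folklore] -/
theorem inputsI2_xiIotaOdd : inputsI2.xiIotaOdd = inputsI.xiIotaOdd * (1 + 3 / 200000) := by
  norm_num [inputsI2, inputsI]

/-- `inputsI2` is dominated by (is weaker than) the published record `inputsI`: fifty-nine fields equal, `xiIotaOdd` larger. [folklore] -/
theorem inputsI_dom_inputsI2 : inputsI.Dom inputsI2 where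
  mu := le_rfl
  muMin := le_rfl
  mubOverMu := le_rfl
  mub := le_rfl
  xiAlphaOneMinusZeroAtZero := le_rfl
  xiAlphaZeroMinusOneAtZero := le_rfl
  xiAlphaOneMinusZeroAtEi := le_rfl
  xiAlphaZeroMinusOneAtEi := le_rfl
  xiIotaAlphaIAtEi := le_rfl
  xiIotaAlphaIIAtZero := le_rfl
  xiIotaAlphaISumAroundEi := le_rfl
  xiIotaAlphaIISumAroundZero := le_rfl
  psiAlphaIOneMinusZeroAroundEi := le_rfl
  psiAlphaIIZeroMinusOneAroundZero := le_rfl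
  psiAlphaIZeroMinusOneAroundEi := le_rfl
  psiAlphaIIOneMinusZeroAroundZero := le_rfl
  piAlpha := le_rfl
  piAlphaLower := le_rfl
  piOneLower := le_rfl
  psiZeroLower := le_rfl
  xiAbs := le_rfl
  xiOdd := le_rfl
  xiEven := le_rfl
  xiEvenTail := le_rfl
  xiOddTail := le_rfl
  xiR0 := le_rfl
  xiR1 := le_rfl
  xiR0Delta := le_rfl
  xiR1Delta := le_rfl
  xiDeltaAbs := le_rfl
  xiOddDelta := le_rfl
  xiEvenDelta := le_rfl
  xiOddTailDelta := le_rfl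
  xiEvenTailDelta := le_rfl
  psiRI0 := le_rfl
  psiRI1 := le_rfl
  psiRII0 := le_rfl
  psiRII1 := le_rfl
  psiRI0Delta := le_rfl
  psiRI1Delta := le_rfl
  psiRII0Delta := le_rfl
  psiRII1Delta := le_rfl
  piR0 := le_rfl
  piR0DeltaEiEk := le_rfl
  xiIotaAbs := le_rfl
  xiIotaOdd := by norm_num [inputsI2, inputsI]
  xiIotaEven := le_rfl
  xiIotaEvenTail := le_rfl
  xiIotaRI0 := le_rfl
  xiIotaRII0 := le_rfl
  xiIotaDeltaEi := le_rfl
  xiIotaOddDeltaEi := le_rfl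
  xiIotaEvenDeltaEi := le_rfl
  xiIotaEvenTailDeltaEi := le_rfl
  xiIotaDeltaZero := le_rfl
  xiIotaOddDeltaZero := le_rfl
  xiIotaEvenDeltaZero := le_rfl
  xiIotaEvenTailDeltaZero := le_rfl
  xiIotaRI0DeltaEi := le_rfl
  xiIotaRII0DeltaZero := le_rfl

/-- sign facts of `inputsI2`. [folklore] -/
theorem inputsI2_nonneg : BetaMap.Inputs.Nonneg inputsI2 := by
  constructor <;> norm_num [inputsI2, inputsI]

/-- `inputsI2` is well formed (`NobleInputsWF 11`): as `inputsI_WF` — the replaced field does not enter (4.34)/`tmp2`. [folklore] -/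
theorem inputsI2_WF : NobleInputsWF 11 inputsI2 :=
  ⟨⟨inputsI2_nonneg, by norm_num [inputsI2, inputsI], by norm_num [inputsI2, inputsI], by norm_num [inputsI2, inputsI],
      by norm_num [inputsI2, inputsI]⟩, by norm_num [inputsI2, inputsI], by norm_num [inputsI2, inputsI]⟩

set_option maxHeartbeats 4000000 in
/-- **Point `i`, the typed record WITH TAILS is dominated by `inputsI2`**, all sixty fields: the thirty-eight tail-free ones and
twenty-one of the tail fields by the kernel decisions of `MeanFieldD11Stage1EvalRec.inpRrec_hi_dom_i` /
`MeanFieldD11Stage1TailsEvalRec.tailsRec_hi_i` against the published numerals (= those of `inputsI2`), and `xiIotaOdd` by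
`xiIotaOddRec_i_within` against the replaced field. [folklore] -/
theorem inpMajQrec_hi_dom_i2 : (inpMajQ dataHi P stateRec .i SQr SbQr).Dom inputsI2 where
  mu := inpRrec_hi_dom_i.mu
  muMin := inpRrec_hi_dom_i.muMin
  mubOverMu := inpRrec_hi_dom_i.mubOverMu
  mub := inpRrec_hi_dom_i.mub
  xiAlphaOneMinusZeroAtZero := inpRrec_hi_dom_i.xiAlphaOneMinusZeroAtZero
  xiAlphaZeroMinusOneAtZero := inpRrec_hi_dom_i.xiAlphaZeroMinusOneAtZero
  xiAlphaOneMinusZeroAtEi := inpRrec_hi_dom_i.xiAlphaOneMinusZeroAtEi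
  xiAlphaZeroMinusOneAtEi := inpRrec_hi_dom_i.xiAlphaZeroMinusOneAtEi
  xiIotaAlphaIAtEi := inpRrec_hi_dom_i.xiIotaAlphaIAtEi
  xiIotaAlphaIIAtZero := inpRrec_hi_dom_i.xiIotaAlphaIIAtZero
  xiIotaAlphaISumAroundEi := inpRrec_hi_dom_i.xiIotaAlphaISumAroundEi
  xiIotaAlphaIISumAroundZero := inpRrec_hi_dom_i.xiIotaAlphaIISumAroundZero
  psiAlphaIOneMinusZeroAroundEi := inpRrec_hi_dom_i.psiAlphaIOneMinusZeroAroundEi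
  psiAlphaIIZeroMinusOneAroundZero := inpRrec_hi_dom_i.psiAlphaIIZeroMinusOneAroundZero
  psiAlphaIZeroMinusOneAroundEi := inpRrec_hi_dom_i.psiAlphaIZeroMinusOneAroundEi
  psiAlphaIIOneMinusZeroAroundZero := inpRrec_hi_dom_i.psiAlphaIIOneMinusZeroAroundZero
  piAlpha := inpRrec_hi_dom_i.piAlpha
  piAlphaLower := inpRrec_hi_dom_i.piAlphaLower
  piOneLower := inpRrec_hi_dom_i.piOneLower
  psiZeroLower := inpRrec_hi_dom_i.psiZeroLower
  xiAbs := castAdd2_le_of _ _ _ (0.01586544446442) _ (by norm_num [inputsI2, inputsI]) tailsRec_hi_i.1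
  xiOdd := castAdd1_le_of _ _ (0.009544447564883) _ (by norm_num [inputsI2, inputsI]) tailsRec_hi_i.2.1
  xiEven := castAdd1_le_of _ _ (0.006320996899537) _ (by norm_num [inputsI2, inputsI]) tailsRec_hi_i.2.2.1
  xiEvenTail := castAdd1_le_of _ _ (0.0006356797510674) _ (by norm_num [inputsI2, inputsI]) tailsRec_hi_i.2.2.2.1
  xiOddTail := castAdd1_le_of _ _ (0.00003464105971714) _ (by norm_num [inputsI2, inputsI]) tailsRec_hi_i.2.2.2.2.1
  xiR0 := inpRrec_hi_dom_i.xiR0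
  xiR1 := inpRrec_hi_dom_i.xiR1
  xiR0Delta := inpRrec_hi_dom_i.xiR0Delta
  xiR1Delta := inpRrec_hi_dom_i.xiR1Delta
  xiDeltaAbs := castAdd2_le_of _ _ _ (0.05090612067868) _ (by norm_num [inputsI2, inputsI]) tailsRec_hi_i.2.2.2.2.2.1
  xiOddDelta := castAdd1_le_of _ _ (0.03128604484227) _ (by norm_num [inputsI2, inputsI]) tailsRec_hi_i.2.2.2.2.2.2.1
  xiEvenDelta := castAdd1_le_of _ _ (0.01962007583641) _ (by norm_num [inputsI2, inputsI]) tailsRec_hi_i.2.2.2.2.2.2.2.1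
  xiOddTailDelta := castAdd1_le_of _ _ (0.0008310621517237) _ (by norm_num [inputsI2, inputsI]) tailsRec_hi_i.2.2.2.2.2.2.2.2.1
  xiEvenTailDelta := castAdd1_le_of _ _ (0.005387422291) _ (by norm_num [inputsI2, inputsI]) tailsRec_hi_i.2.2.2.2.2.2.2.2.2.1
  psiRI0 := inpRrec_hi_dom_i.psiRI0
  psiRI1 := inpRrec_hi_dom_i.psiRI1
  psiRII0 := inpRrec_hi_dom_i.psiRII0
  psiRII1 := inpRrec_hi_dom_i.psiRII1
  psiRI0Delta := inpRrec_hi_dom_i.psiRI0Delta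
  psiRI1Delta := inpRrec_hi_dom_i.psiRI1Delta
  psiRII0Delta := inpRrec_hi_dom_i.psiRII0Delta
  psiRII1Delta := inpRrec_hi_dom_i.psiRII1Delta
  piR0 := inpRrec_hi_dom_i.piR0
  piR0DeltaEiEk := inpRrec_hi_dom_i.piR0DeltaEiEk
  xiIotaAbs := castAdd2_le_of _ _ _ (0.003432945071359) _ (by norm_num [inputsI2, inputsI]) tailsRec_hi_i.2.2.2.2.2.2.2.2.2.2.1
  xiIotaOdd := castAdd1_le_of _ _ (0.0006291245273866 * (1 + 3 / 200000)) _ (by norm_num [inputsI2, inputsI]) xiIotaOddRec_i_within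
  xiIotaEven := castAdd1_le_of _ _ (0.002803820543973) _ (by norm_num [inputsI2, inputsI]) tailsRec_hi_i.2.2.2.2.2.2.2.2.2.2.2.1
  xiIotaEvenTail := castAdd1_le_of _ _ (0.00003913597972002) _ (by norm_num [inputsI2, inputsI]) tailsRec_hi_i.2.2.2.2.2.2.2.2.2.2.2.2.1
  xiIotaRI0 := inpRrec_hi_dom_i.xiIotaRI0
  xiIotaRII0 := inpRrec_hi_dom_i.xiIotaRII0
  xiIotaDeltaEi := castAdd2_le_of _ _ _ (0.002418817100675) _ (by norm_num [inputsI2, inputsI]) tailsRec_hi_i.2.2.2.2.2.2.2.2.2.2.2.2.2.1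
  xiIotaOddDeltaEi := castAdd1_le_of _ _ (0.002013259317904) _ (by norm_num [inputsI2, inputsI]) tailsRec_hi_i.2.2.2.2.2.2.2.2.2.2.2.2.2.2.1
  xiIotaEvenDeltaEi := castAdd1_le_of _ _ (0.0004055577827712) _ (by norm_num [inputsI2, inputsI]) tailsRec_hi_i.2.2.2.2.2.2.2.2.2.2.2.2.2.2.2.1
  xiIotaEvenTailDeltaEi := castAdd1_le_of _ _ (0.000366431430925) _ (by norm_num [inputsI2, inputsI]) tailsRec_hi_i.2.2.2.2.2.2.2.2.2.2.2.2.2.2.2.2.1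
  xiIotaDeltaZero := castAdd2_le_of _ _ _ (0.008727051160038) _ (by norm_num [inputsI2, inputsI]) tailsRec_hi_i.2.2.2.2.2.2.2.2.2.2.2.2.2.2.2.2.2.1
  xiIotaOddDeltaZero := castAdd1_le_of _ _ (0.005252884404806) _ (by norm_num [inputsI2, inputsI]) tailsRec_hi_i.2.2.2.2.2.2.2.2.2.2.2.2.2.2.2.2.2.2.1
  xiIotaEvenDeltaZero := castAdd1_le_of _ _ (0.003474166755233) _ (by norm_num [inputsI2, inputsI]) tailsRec_hi_i.2.2.2.2.2.2.2.2.2.2.2.2.2.2.2.2.2.2.2.1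
  xiIotaEvenTailDeltaZero := castAdd1_le_of _ _ (0.0006703558391341) _ (by norm_num [inputsI2, inputsI]) tailsRec_hi_i.2.2.2.2.2.2.2.2.2.2.2.2.2.2.2.2.2.2.2.2
  xiIotaRI0DeltaEi := inpRrec_hi_dom_i.xiIotaRI0DeltaEi
  xiIotaRII0DeltaZero := inpRrec_hi_dom_i.xiIotaRII0DeltaZero

/-- **(S2a) transport, initial point, the typed record WITH TAILS → `inputsI2`.** [cite: FitznerVanDerHofstad2016NoBLE, Assumption 4.3 pp. 1086–1088 (z = z_I)]
[cite: FitznerVanDerHofstad2017, §§4–6; notebook Percolation.nb cells 41–44] -/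
theorem nobleAssumption43At_inputsI2_of_stage1Full {p : unitInterval} {S : NobleSplit 11 p}
    (h : NobleAssumption43At 11 p S (inpMajQ dataHi P stateRec .i SQr SbQr)) : NobleAssumption43At 11 p S inputsI2 :=
  h.of_dom inpMajQrec_hi_dom_i2 inputsI2_WF.1

/-- Assumption 4.3 with the PUBLISHED initial-point constants also implies it with `inputsI2` (`inputsI_dom_inputsI2`). [folklore] -/
theorem nobleAssumption43At_inputsI2_of_inputsI {p : unitInterval} {S : NobleSplit 11 p}
    (h : NobleAssumption43At 11 p S inputsI) : NobleAssumption43At 11 p S inputsI2 :=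
  h.of_dom inputsI_dom_inputsI2 inputsI2_WF.1

/-- (N1′) at `inputsI2` (the fields entering `c_Φ^low` are those of `inputsI`). [cite: FitznerVanDerHofstad2016NoBLE, App. D (D.9)–(D.10) p. 1111] -/
theorem n1_inputsI2 :
    0 ≤ BetaMap.betaCPhiLow ((11 : ℕ) : ℝ) inputsI2.mu inputsI2.xiAlphaOneMinusZeroAtZero inputsI2.xiIotaAlphaIAtEi :=
  n1_inputsI

/-- (N2) at `inputsI2`. [cite: FitznerVanDerHofstad2016NoBLE, App. D Step 2 p. 1111] -/
theorem n2_inputsI2 : inputsI2.xiAbs + inputsI2.xiIotaAbs < 1 := n2_inputsI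

/-- (N3) at `inputsI2` (`β_Ψ̂` does not read `xiIotaOdd`). [cite: FitznerVanDerHofstad2016NoBLE, App. D (D.4) p. 1110] -/
theorem n3_inputsI2 : (BetaMap.nobleBetaOfInputs ((11 : ℕ) : ℝ) inputsI2).βΨ < 1 := n3_inputsI

/-- `α_F^low` does not read `xiIotaOdd`. [folklore] -/
theorem beta_inputsI2_αFlow :
    (BetaMap.nobleBetaOfInputs ((11 : ℕ) : ℝ) inputsI2).αFlow = (BetaMap.nobleBetaOfInputs ((11 : ℕ) : ℝ) inputsI).αFlow := rfl

/-- `β_Δ` is monotone in `xiIotaOdd` at these inputs: the published `β_Δ(inputsI)` is `≤ β_Δ(inputsI2)` (kernel `norm_num` through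
the typed (D.32)). [cite: FitznerVanDerHofstad2016NoBLE, App. D (D.32) p. 1117] -/
theorem beta_inputsI_βΔ_le :
    (BetaMap.nobleBetaOfInputs ((11 : ℕ) : ℝ) inputsI).βΔ ≤ (BetaMap.nobleBetaOfInputs ((11 : ℕ) : ℝ) inputsI2).βΔ := by
  norm_num [BetaMap.nobleBetaOfInputs, BetaMap.betaRfDeltaLower, inputsI2, inputsI]

/-- **The `F`-side dispersive hypothesis at the PUBLISHED `β(inputsI)` implies the one at `β(inputsI2)`** (`α_F^low` equal,
`β_Δ` larger, `1 − D̂ ≥ 0`): the oracle lane's target statement is unchanged by the auxiliary record. [cite: FitznerVanDerHofstad2016NoBLE, App. D (D.3)+(D.32)] -/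
theorem fSide_inputsI2_of_inputsI
    (hF : ∀ k ∈ cube 11,
      ((BetaMap.nobleBetaOfInputs ((11 : ℕ) : ℝ) inputsI).αFlow - (BetaMap.nobleBetaOfInputs ((11 : ℕ) : ℝ) inputsI).βΔ) *
        (1 - Dhat 11 k) ≤ cosFT (nobleF 11 (nbwThresholdI 11)) 0 - cosFT (nobleF 11 (nbwThresholdI 11)) k) :
    ∀ k ∈ cube 11,
      ((BetaMap.nobleBetaOfInputs ((11 : ℕ) : ℝ) inputsI2).αFlow - (BetaMap.nobleBetaOfInputs ((11 : ℕ) : ℝ) inputsI2).βΔ) *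
        (1 - Dhat 11 k) ≤ cosFT (nobleF 11 (nbwThresholdI 11)) 0 - cosFT (nobleF 11 (nbwThresholdI 11)) k := by
  intro k hk
  refine le_trans (mul_le_mul_of_nonneg_right ?_ (one_sub_Dhat_nonneg k)) (hF k hk)
  rw [beta_inputsI2_αFlow]
  exact sub_le_sub_left beta_inputsI_βΔ_le _

/-- **The input-level certificate with the auxiliary initial record `inputsI2`** (improvement stage = the record's `inputsO`):
the three initial-stage inequalities re-evaluated by `norm_num` through the typed App.-D map (margins at the initial stage are
`γ₁ − f₁(i) ≈ 1.6·10⁻³`, `γ₂ − f₂(i) ≈ 4.5·10⁻²`, header of `MeanFieldD11Inputs`; the replaced field moves `β` by `< 10⁻⁷`); the other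
six are those of `nobleCertificate_d11_inputs`.  NOT a certificate of record. [cite: FitznerVanDerHofstad2017, §2.5–§2.7 (d = 11); FitznerVanDerHofstad2016NoBLE, App. D] -/
theorem nobleCertificate_d11_inputsI2 :
    NobleNumericCertificate 11 cMuC cWeightsC gammaC GammaC (BetaMap.nobleBetaOfInputs 11 inputsI2)
      (BetaMap.nobleBetaOfInputs 11 inputsO) bi bo where
  one_lt_cμ := nobleCertificate_d11_inputs.one_lt_cμ
  c_pos := nobleCertificate_d11_inputs.c_pos
  γ_lt_Γ := nobleCertificate_d11_inputs.γ_lt_Γ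
  admissible_init := by norm_num [NobleBeta.Admissible, inputsI2, inputsI, BetaMap.nobleBetaOfInputs, BetaMap.betaMubarOverMu, BetaMap.betaCPhiUp, BetaMap.betaAfLow, BetaMap.betaapI, BetaMap.betaapII, BetaMap.betaPiHat, BetaMap.betaPsiHatLower, BetaMap.betaRp, BetaMap.betaRfDeltaLower]
  admissible := nobleCertificate_d11_inputs.admissible
  f1Bound_init_le := by norm_num [NobleBeta.f1Bound, inputsI2, inputsI, cMuC, gammaC, max_def, BetaMap.nobleBetaOfInputs, BetaMap.betaMubarOverMu, BetaMap.betaCPhiUp, BetaMap.betaAfLow, BetaMap.betaapI, BetaMap.betaapII, BetaMap.betaPiHat, BetaMap.betaPsiHatLower, BetaMap.betaRp, BetaMap.betaRfDeltaLower]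
  f2Bound_init_le := by norm_num [NobleBeta.f2Bound, inputsI2, inputsI, gammaC, max_def, BetaMap.nobleBetaOfInputs, BetaMap.betaMubarOverMu, BetaMap.betaCPhiUp, BetaMap.betaAfLow, BetaMap.betaapI, BetaMap.betaapII, BetaMap.betaPiHat, BetaMap.betaPsiHatLower, BetaMap.betaRp, BetaMap.betaRfDeltaLower]
  f3_init_le := nobleCertificate_d11_inputs.f3_init_le
  f1Bound_le := nobleCertificate_d11_inputs.f1Bound_le
  f2Bound_le := nobleCertificate_d11_inputs.f2Bound_le
  f3_le := nobleCertificate_d11_inputs.f3_le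

/-- [NoBLE17] (4.52) in `≤` form at `p_I` with the `β`-table of `inputsI2`. [cite: FitznerVanDerHofstad2016NoBLE, Prop. 4.5 (i) p. 1088; App. D] -/
theorem nobleSimplifiedFormAt_d11_i2
    (h43 : NobleAssumption43At 11 (nbwThresholdI 11)
      (percolationNobleSplit 11 (nbwThresholdI 11) two_le_eleven (nbwThresholdI_lt_criticalProbI two_le_eleven)) inputsI2)
    (hF : ∀ k ∈ cube 11,
      ((BetaMap.nobleBetaOfInputs ((11 : ℕ) : ℝ) inputsI2).αFlow - (BetaMap.nobleBetaOfInputs ((11 : ℕ) : ℝ) inputsI2).βΔ) *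
        (1 - Dhat 11 k) ≤ cosFT (nobleF 11 (nbwThresholdI 11)) 0 - cosFT (nobleF 11 (nbwThresholdI 11)) k) :
    NobleSimplifiedFormAt 11 (nbwThresholdI 11) (BetaMap.nobleBetaOfInputs ((11 : ℕ) : ℝ) inputsI2) :=
  have hp := nbwThresholdI_lt_criticalProbI two_le_eleven
  have hp0 : 0 < ((nbwThresholdI 11 : unitInterval) : ℝ) := nbwThresholdI_pos (by norm_num)
  nobleSimplifiedFormAt_percolation two_le_eleven hp hp0 inputsI2_WF
    (percolationNobleEquationAt_of_summable two_le_eleven hp hp0 h43.xiAbs.2.1 fun ι => (h43.xiIotaAbs ι).2.1)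
    h43 n1_inputsI2 n2_inputsI2 n3_inputsI2 hF

/-- **The initial-step oracle binder at `d = 11` with the `β`-table of `inputsI2`, (S2a) at the typed recipe's outputs WITH TAILS and
the `F`-side hypothesis at the PUBLISHED `β(inputsI)`.** [cite: FitznerVanDerHofstad2016NoBLE, Prop. 4.5 (p. 1088); Assumption 4.3 (z = z_I)]
[cite: FitznerVanDerHofstad2017, Prop. 2.2 (EJP p. 11); §§4–6] -/
theorem nobleInitialInputsAt_d11_typedStage1
    (hI43 : NobleAssumption43At 11 (nbwThresholdI 11)
      (percolationNobleSplit 11 (nbwThresholdI 11) two_le_eleven (nbwThresholdI_lt_criticalProbI two_le_eleven))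
      (inpMajQ dataHi P stateRec .i SQr SbQr))
    (hIF : ∀ k ∈ cube 11,
      ((BetaMap.nobleBetaOfInputs ((11 : ℕ) : ℝ) inputsI).αFlow - (BetaMap.nobleBetaOfInputs ((11 : ℕ) : ℝ) inputsI).βΔ) *
        (1 - Dhat 11 k) ≤ cosFT (nobleF 11 (nbwThresholdI 11)) 0 - cosFT (nobleF 11 (nbwThresholdI 11)) k)
    (hIW : NobleWeightedDiagramBoundAt 11 (nbwThresholdI 11) bi) :
    NobleInitialInputsAt 11 (BetaMap.nobleBetaOfInputs 11 inputsI2) bi := by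
  have hS := nobleSimplifiedFormAt_d11_i2 (nobleAssumption43At_inputsI2_of_stage1Full hI43) (fSide_inputsI2_of_inputsI hIF)
  simp only [Nat.cast_ofNat] at hS
  exact ⟨hS, hIW⟩

/-- **Mean-field behaviour at `d = 11` on the kernel App.-D line with BOTH Assumption-4.3 hypotheses stated at the typed Stage-1
recipe's outputs (record cell, tails included, certified SRW tables).**  REMAINING HYPOTHESES (displayed, not citable as typed):
(S2a′ at `p_I`) Assumption 4.3 for the percolation split at `p_I` with the constants `inpMajQ dataHi P stateRec .i SQr SbQr`;
(S2a′) the same on `(p_I, p_c)` under `f ≤ Γ` with the constants `inpMajQ dataHi P stateRec .o SQr SbQr`; (S2b) [FvdH17] Prop. 2.2's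
weighted-diagram bounds `bi`, `bo`; (F) App. D (D.3)+(D.32) at the PUBLISHED `β(inputsI)` / `β(inputsO)`.  Assembly: the typed record at
`i` is dominated by the auxiliary record `inputsI2` (`inpMajQrec_hi_dom_i2`), at `o` by `inputsO` (`inpMajQrec_hi_dom_o`); Assumption 4.3
is transported along both (`NobleAssumption43At.of_dom`); the `F`-hypothesis at `β(inputsI)` implies the one at `β(inputsI2)`
(`fSide_inputsI2_of_inputsI`); the certificate `P(γ, Γ)` holds at `(β(inputsI2), β(inputsO))` (`nobleCertificate_d11_inputsI2`, kernel);
[NoBLE17] Thm 2.10 / Prop. 2.11 (`meanField_of_certificate`).  No published Stage-1 decimal remains in an (S2a) hypothesis.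
[cite: FitznerVanDerHofstad2017, Thm 1.1 / Cor. 1.3 (d = 11: the bootstrap inequalities re-evaluated with certified arithmetic, Cert rev 6; analytic hypotheses typed, see header)]
[cite: FitznerVanDerHofstad2016NoBLE, Thm 2.10, Prop. 2.11, Prop. 4.5, App. D] -/
theorem meanField_d11_typedStage1
    (hI43 : NobleAssumption43At 11 (nbwThresholdI 11)
      (percolationNobleSplit 11 (nbwThresholdI 11) two_le_eleven (nbwThresholdI_lt_criticalProbI two_le_eleven))
      (inpMajQ dataHi P stateRec .i SQr SbQr))
    (hIF : ∀ k ∈ cube 11,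
      ((BetaMap.nobleBetaOfInputs ((11 : ℕ) : ℝ) inputsI).αFlow - (BetaMap.nobleBetaOfInputs ((11 : ℕ) : ℝ) inputsI).βΔ) *
        (1 - Dhat 11 k) ≤ cosFT (nobleF 11 (nbwThresholdI 11)) 0 - cosFT (nobleF 11 (nbwThresholdI 11)) k)
    (hIW : NobleWeightedDiagramBoundAt 11 (nbwThresholdI 11) bi)
    (hS : ∀ (p : unitInterval) (hp : p ∈ Set.Ioo (nbwThresholdI 11) (criticalProbI 11)),
      (∀ j, Literature.Barriers.CriticalPhenomena.nobleF 11 cMuC cWeightsC j p ≤ GammaC j) →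
        NobleAssumption43At 11 p (percolationNobleSplit 11 p two_le_eleven hp.2) (inpMajQ dataHi P stateRec .o SQr SbQr) ∧
        (∀ k ∈ cube 11,
          ((BetaMap.nobleBetaOfInputs ((11 : ℕ) : ℝ) inputsO).αFlow -
              (BetaMap.nobleBetaOfInputs ((11 : ℕ) : ℝ) inputsO).βΔ) * (1 - Dhat 11 k) ≤
            cosFT (nobleF 11 p) 0 - cosFT (nobleF 11 p) k) ∧
        NobleWeightedDiagramBoundAt 11 p bo) :
    TriangleCondition 11 ∧ PercolationContinuity 11 ∧ BetaEqOneBoundedRatio 11 :=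
  meanField_of_certificate (by norm_num) nobleCertificate_d11_inputsI2 (nobleInitialInputsAt_d11_typedStage1 hI43 hIF hIW)
    (nobleImprovementInputsAt_d11_stage1 hS)

/-- `θ(p_c) = 0` on `ℤ^11`, both Assumption-4.3 hypotheses at the typed Stage-1 recipe's outputs (hypotheses as in
`meanField_d11_typedStage1`). [cite: FitznerVanDerHofstad2017, Cor. 1.3 (d = 11)] -/
theorem percolationContinuity_d11_typedStage1
    (hI43 : NobleAssumption43At 11 (nbwThresholdI 11)
      (percolationNobleSplit 11 (nbwThresholdI 11) two_le_eleven (nbwThresholdI_lt_criticalProbI two_le_eleven))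
      (inpMajQ dataHi P stateRec .i SQr SbQr))
    (hIF : ∀ k ∈ cube 11,
      ((BetaMap.nobleBetaOfInputs ((11 : ℕ) : ℝ) inputsI).αFlow - (BetaMap.nobleBetaOfInputs ((11 : ℕ) : ℝ) inputsI).βΔ) *
        (1 - Dhat 11 k) ≤ cosFT (nobleF 11 (nbwThresholdI 11)) 0 - cosFT (nobleF 11 (nbwThresholdI 11)) k)
    (hIW : NobleWeightedDiagramBoundAt 11 (nbwThresholdI 11) bi)
    (hS : ∀ (p : unitInterval) (hp : p ∈ Set.Ioo (nbwThresholdI 11) (criticalProbI 11)),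
      (∀ j, Literature.Barriers.CriticalPhenomena.nobleF 11 cMuC cWeightsC j p ≤ GammaC j) →
        NobleAssumption43At 11 p (percolationNobleSplit 11 p two_le_eleven hp.2) (inpMajQ dataHi P stateRec .o SQr SbQr) ∧
        (∀ k ∈ cube 11,
          ((BetaMap.nobleBetaOfInputs ((11 : ℕ) : ℝ) inputsO).αFlow -
              (BetaMap.nobleBetaOfInputs ((11 : ℕ) : ℝ) inputsO).βΔ) * (1 - Dhat 11 k) ≤
            cosFT (nobleF 11 p) 0 - cosFT (nobleF 11 p) k) ∧
        NobleWeightedDiagramBoundAt 11 p bo) :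
    PercolationContinuity 11 :=
  (meanField_d11_typedStage1 hI43 hIF hIW hS).2.1

end D11

end Literature.Probability.FitznerVanDerHofstad2017
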